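import Literature.NumberTheory.Automorphic.RamakrishnanTheoremMOnlyIfProofs
import Literature.NumberTheory.Automorphic.AutomorphicRepsGLCuspidalUnitaryHolds
import HarnessLib

/-!
# Ramakrishnan (2000), Lemma 3.1.1 (II), (III): the Existence clause of Theorem M for pairs of
# special type (named facts), and Theorem M assembled from the named facts of the tree

Topic `NumberTheory/Automorphic`; namespace `Literature.NumberTheory.Automorphic`.
Fact-decomposition record (librarian, `fact-decompose`, 2026-08-16) for the named fact
`Ramakrishnan2000_theoremM` (`RamakrishnanTensorProductGL2.lean`; D. Ramakrishnan, *Modularity of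
the Rankin–Selberg `L`-series, and multiplicity one for `SL(2)`*, Ann. of Math. 152 (2000),
Theorem M: Existence of `π ⊠ π'` on `GL(4)` for every cuspidal pair on `GL(2)/F`, and the
cuspidality criterion for pairs neither of whose members is dihedral — at the level of Satake
parameters almost everywhere).

State of the printed proof in the tree (`RamakrishnanTheoremMOnlyIfProofs`,
`Ramakrishnan2000_theoremM.of_boxTimes_cuspidal_of_special_types`): Theorem M follows from
* the cuspidal-case fact `Ramakrishnan2000_boxTimes_cuspidal` (Theorem M for pairs of GENERAL type,
  §§3.2–3.7: Existence of a cuspidal `π ⊠ π'` and the "if" half of the criterion; named fact of the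
  tree, itself proved from the leaves of §3.7 in `RamakrishnanBoxTimesDescent`);
* the Existence clause in the SPECIAL types (II), (III) of Lemma 3.1.1 (§3.1, preprint pp. 10–11:
  "Theorem M holds in the following three special cases: (I) At least one of `{π, π'}` is not
  cuspidal. (II) At least one of `{π, π'}` is automorphically induced by a character `μ` of (the
  idele class group of) a quadratic extension `K` of `F`. (III) `π'` is a twist of `π`, i.e., there
  exists a character `χ` of `C_F` such that `π' ≃ π ⊗ χ`"; printed proofs: `π ⊠ I(μ) = I_K^F(π_K ⊗ μ)`
  and `π ⊠ (π ⊗ χ) = (sym²(π) ⊗ χ) ⊞ ωχ`, by automorphic induction of `GL(2)` data [Arthur–Clozel]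
  and isobaric sums [Jacquet–Shalika], neither available in the tree) — so far only the inline
  hypotheses `hII`, `hIII`;
* the "only if" half of the criterion, PROVED there from the `L²` facts Jacquet–Shalika (2.2) at
  `s = 1` for different ranks (`JacquetShalika1981_partialPairL_at_one_of_rank_ne`) and (2.3)
  (`JacquetShalika1981_partialPairL_pole_of_eq_conj`) — named facts of the tree — and the
  semisimplicity of `𝒜_cusp^{A_G}` (`AutomorphicRepsGL.stable_cuspidal_eq_sSup_irreducible`, since
  discharged: `…_holds`, `AutomorphicRepsGLCuspidalUnitaryHolds`).

This file NAMES the two special-type Existence statements as the facts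
`Ramakrishnan2000_lemma311_II` and `Ramakrishnan2000_lemma311_III` (the binders `hII`, `hIII`
verbatim; case (I) is void for cuspidal data) and records the assembly
`Ramakrishnan2000_theoremM_holds_of` from them, `Ramakrishnan2000_boxTimes_cuspidal` and the two
Jacquet–Shalika facts (one line). Renderings ("dihedral" = `IsSatakeSelfTwist`, "twist" =
`IsSatakeTwistBy`, Satake parameters a.e.) are those of `RamakrishnanTensorProductGL2` (module
docstring there).

## References

* [Ramakrishnan2000] D. Ramakrishnan, Modularity of the Rankin–Selberg `L`-series, and multiplicity
  one for `SL(2)`, Ann. of Math. (2) 152 (2000) 45–111: §3.1 Lemma 3.1.1 (preprint pp. 10–11),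
  Theorem M (§3), Prop. 3.2.1, §3.7.
* [ArthurClozelAMS120] J. Arthur, L. Clozel, Simple algebras, base change, and the advanced theory
  of the trace formula, Ann. of Math. Stud. 120 (1989), Ch. 3 §6 (automorphic induction).
* [JacquetShalikaAJM1981II] H. Jacquet, J. A. Shalika, On Euler products and the classification of
  automorphic forms II, Amer. J. Math. 103 (1981) 777–815 (isobaric sums, Thm. 4.4).
-/

noncomputable section

open scoped MatrixGroups Topology Classical NNReal
open NumberField IsDedekindDomain MeasureTheory Filter

namespace Literature.NumberTheory.Automorphic

open AdelicGroupData
open Literature.NumberTheory.GaloisRepresentations (HeckeCharacter)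

/-- NAMED FACT — **Ramakrishnan 2000, Lemma 3.1.1, case (II): Existence of `π ⊠ π'` when `π` is
dihedral.** For a number field `F` and cuspidal automorphic representations `π, π'` of `GL(2, 𝔸_F)`
(Borel–Jacquet data) such that `π` admits a non-trivial self-twist (`IsSatakeSelfTwist`, the
rendering of "`π = I_K^F(μ)` is automorphically induced from a character of a quadratic extension"
through op. cit. Prop. 2.3.1 (2)), there is an automorphic representation `Π` of `GL(4, 𝔸_F)` whose
Satake parameter at almost every finite place `v` is `{αᵢ βⱼ}` (`satakeTensor α β`) for the Satake
parameters `α` of `π` and `β` of `π'` at `v`. Printed proof: `π ⊠ π' = I_K^F(μ ⊗ π'_K)`, automorphic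
induction of the base change (Arthur–Clozel). By the symmetry of `satakeTensor` this also covers a
dihedral `π'`. The hypothesis `hII` of
`Ramakrishnan2000_theoremM.of_boxTimes_cuspidal_of_special_types` verbatim; users take
`(h : Ramakrishnan2000_lemma311_II)`. [cite: Ramakrishnan2000, Lemma 3.1.1 (II) (§3.1)] -/
def Ramakrishnan2000_lemma311_II : Prop :=
  ∀ (F : Type) [Field F] [NumberField F]
    (h2 : isCompact_glFiniteIntegralLevel 2 F) (h4 : isCompact_glFiniteIntegralLevel 4 F)
    (π π' : CuspidalAutomorphicRepData 2 F h2), IsSatakeSelfTwist π.1 →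
    ∃ P : AutomorphicRepData (AutomorphyDatum.gl 4 F h4),
      ∀ᶠ v : HeightOneSpectrum (𝓞 F) in cofinite, ∀ α β : Multiset ℂ,
        π.1.HasSatakeParamAt v α → π'.1.HasSatakeParamAt v β →
          P.HasSatakeParamAt v (satakeTensor α β)

/-- NAMED FACT — **Ramakrishnan 2000, Lemma 3.1.1, case (III): Existence of `π ⊠ π'` when `π'` is
a twist of `π`.** For a number field `F`, cuspidal automorphic representations `π, π'` of
`GL(2, 𝔸_F)` (Borel–Jacquet data) neither of which admits a non-trivial self-twist, and a Hecke
character `χ` with `t_{π',v} = χ(ϖ_v) t_{π,v}` for almost all `v` (`IsSatakeTwistBy π π' χ`, the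
rendering of "`π' ≃ π ⊗ χ`"), there is an automorphic representation `Π` of `GL(4, 𝔸_F)` with Satake
parameters `{αᵢ βⱼ}` at almost all finite places. Printed proof: `π ⊠ (π ⊗ χ) = (sym²(π) ⊗ χ) ⊞ ωχ`
(Gelbart–Jacquet lift and an isobaric sum, Jacquet–Shalika). The hypothesis `hIII` of
`Ramakrishnan2000_theoremM.of_boxTimes_cuspidal_of_special_types` verbatim; users take
`(h : Ramakrishnan2000_lemma311_III)`. [cite: Ramakrishnan2000, Lemma 3.1.1 (III) (§3.1)] -/
def Ramakrishnan2000_lemma311_III : Prop :=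
  ∀ (F : Type) [Field F] [NumberField F]
    (h2 : isCompact_glFiniteIntegralLevel 2 F) (h4 : isCompact_glFiniteIntegralLevel 4 F)
    (π π' : CuspidalAutomorphicRepData 2 F h2) (χ : HeckeCharacter F),
    ¬ IsSatakeSelfTwist π.1 → ¬ IsSatakeSelfTwist π'.1 → IsSatakeTwistBy π.1 π'.1 χ →
    ∃ P : AutomorphicRepData (AutomorphyDatum.gl 4 F h4),
      ∀ᶠ v : HeightOneSpectrum (𝓞 F) in cofinite, ∀ α β : Multiset ℂ,
        π.1.HasSatakeParamAt v α → π'.1.HasSatakeParamAt v β →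
          P.HasSatakeParamAt v (satakeTensor α β)

/-- **Assembly (fact-decompose): Theorem M from the named facts of the tree.**
`Ramakrishnan2000_theoremM` follows from the cuspidal-case fact `Ramakrishnan2000_boxTimes_cuspidal`
(general type), Lemma 3.1.1 (II), (III) (`Ramakrishnan2000_lemma311_II`, `…_III`), and the `L²`
facts Jacquet–Shalika (2.2) at `s = 1` for different ranks and (2.3)
(`JacquetShalika1981_partialPairL_at_one_of_rank_ne`, `JacquetShalika1981_partialPairL_pole_of_eq_conj`)
— through `Ramakrishnan2000_theoremM.of_boxTimes_cuspidal_of_special_types`, its semisimplicity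
leaf being the theorem `AutomorphicRepsGL.stable_cuspidal_eq_sSup_irreducible_holds`.
[cite: Ramakrishnan2000, Theorem M (§3), Lemma 3.1.1 and Prop. 3.2.1] -/
theorem Ramakrishnan2000_theoremM_holds_of (h : Ramakrishnan2000_boxTimes_cuspidal)
    (hII : Ramakrishnan2000_lemma311_II) (hIII : Ramakrishnan2000_lemma311_III)
    (hrk : ∀ {n m : ℕ} {K : Type} [Field K] [NumberField K]
      {μ : Measure (gl n K).automorphicQuotient} [(gl n K).IsAutomorphicMeasure μ]
      {μ' : Measure (gl m K).automorphicQuotient} [(gl m K).IsAutomorphicMeasure μ'],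
      JacquetShalika1981_partialPairL_at_one_of_rank_ne (n := n) (m := m) (K := K) (μ := μ)
        (μ' := μ'))
    (h23 : ∀ {n : ℕ} {K : Type} [Field K] [NumberField K] {μ : Measure (gl n K).automorphicQuotient}
      [(gl n K).IsAutomorphicMeasure μ],
      JacquetShalika1981_partialPairL_pole_of_eq_conj (n := n) (K := K) (μ := μ)) :
    Ramakrishnan2000_theoremM :=
  Ramakrishnan2000_theoremM.of_boxTimes_cuspidal_of_special_types h hII hIII hrk h23
    fun hK => AutomorphicRepsGL.stable_cuspidal_eq_sSup_irreducible_holds (hcpt := hK)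

end Literature.NumberTheory.Automorphic

end
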